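import Summits.HodgeConjecture.HodgeConjecture.Theses.HeckePrymWeil
import Summits.HodgeConjecture.HodgeConjecture.Theorems.Ring2HypothesesDescentMotivatedPullbackLift
import HarnessLib

/-!
# Crux `SummitOffWeilSector` (stmt-HodgeConjecture-14374), line `motivated_anchor_split` — registered stub
# `stub_andreSemisimpleLift`, CLOSED BY NAME

Route `HeckePrymWeil` of `HodgeConjecture`. The registered skeleton
`Cruxes/SummitOffWeilSector/Lines/motivated_anchor_split.lean` names as its stub 4, BY NAME, the
Literature named fact

  `Literature.AlgebraicGeometry.HodgeTheory.Andre1996_exists_motivated_of_motivated_pullback`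

(leaf (A3) of André's deformation theorem for motivated cycles, *Pour une théorie inconditionnelle des
motifs*, Publ. Math. IHÉS 83 (1996), §0.5 / Thm. 0.5: André's semisimple lift — a motivated class on the
fibre which is the pull-back of SOME class of the total space is the pull-back of a MOTIVATED class). That
fact is a THEOREM of the tree (`Theorems.Andre1996_exists_motivated_of_motivated_pullback_holds`,
`Theorems/Ring2HypothesesDescentMotivatedPullbackLift.lean`, cell `pub-hodge-ring2` row b05: numerical
motives of the pair, semisimplicity à la Jannsen–André, motivated projectors), landed after the skeleton was
registered and never credited to the stub. This file records the registered signature. No mathematics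
beyond the citation of the tree theorem.

## References

* [Andre1996] Y. André, Pour une théorie inconditionnelle des motifs, Publ. Math. IHÉS 83 (1996), Thm. 0.5
  and §4.
-/

noncomputable section

-- `Summit.HodgeConjecture.HodgeConjecture.…` is the mandated namespace (single-conjunct summit).
set_option linter.dupNamespace false

namespace Summit.HodgeConjecture.HodgeConjecture.Theorems.SummitOffWeilSector

/-- **Registered stub `stub_andreSemisimpleLift` of the line `motivated_anchor_split`** (crux
`SummitOffWeilSector`, stmt-HodgeConjecture-14374), verbatim: the named fact
`Andre1996_exists_motivated_of_motivated_pullback` (André's semisimple lift of motivated classes through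
the restriction to a fibre). Discharged by the tree theorem
`Theorems.Andre1996_exists_motivated_of_motivated_pullback_holds`. [cite: Andre1996, Thm. 0.5 and §4] -/
theorem stub_andreSemisimpleLift :
    Literature.AlgebraicGeometry.HodgeTheory.Andre1996_exists_motivated_of_motivated_pullback :=
  Summit.HodgeConjecture.HodgeConjecture.Theorems.Andre1996_exists_motivated_of_motivated_pullback_holds

end Summit.HodgeConjecture.HodgeConjecture.Theorems.SummitOffWeilSector

end
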